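import Mathlib
import Summits.QuantumFields.QCD.Theses.EulerDescent

/-!
# First lemmas of the UPPER LOCATOR `stub_offsetBoundedAbove` of line `bounded_locator` for the crux
# `EulerDescent.HonestHeavyAnchor` (item stmt-QuantumFields-16901): the DECOUPLING MECHANISM

Helper file (def-free, sorry-free) of worker `stub_offsetBoundedAbove` (lead prover-line-stmt-QuantumFields-16901-0,
cycle 1).  The stub itself — "the renormalised corner offset `(m_crit(k) − mc(k))·Z_m(k)/a_k` of a mass-scaling,
asymptotically scaling regularisation with a closing intrinsic Wilson corner and a heavy body is eventually bounded
ABOVE" — is open-problem grade (its core needs a decay rate of the flavour-changing pseudoscalar channel at the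
RENORMALISED quark mass measured from the intrinsic corner; configuration-wise Combes–Thomas / Vafa–Witten bounds see
only the bare mass, `Literature.Barriers.QuantumFields.VafaWittenEigenvalueBound`).  What IS closed, and landed here,
is the pair of analytic facts by which a divergent channel rate kills a non-trivial limit (skeleton
`Cruxes/HonestHeavyAnchor/Lines/bounded_locator.lean` §6), in three currencies:

* §1 (continuum / OS side) `laplace_ratio_lower_bound`: a Laplace transform `S(t) = ∫ e^{−Et} dρ(E)` of a finite
  positive measure with `ρ(−∞, R) = 0`, `R ≥ 0`, obeys `e^{R (t₁ − t')} S(t₁) ≤ S(t')` for `0 ≤ t' ≤ t₁`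
  (the spectral measure of `Θf` in the OS-reconstructed Hamiltonian, `S(t) = ⟨Θf, e^{−tH} f⟩`);
* §2 (lattice / transfer-matrix side) `spectralSum_ratio_lower_bound`: a positive-type sequence
  `s(n) = Σ_j w_j q_j^n`, `w_j ≥ 0`, `0 ≤ q_j ≤ e^{−E}`, obeys `e^{E (n₁ − n₀)} s(n₁) ≤ s(n₀)` for `n₀ ≤ n₁`
  (the spectral decomposition of `⟨v, 𝕋ⁿ v⟩` for Lüscher's positive transfer matrix `𝕋` of `r = 1` Wilson quarks,
  `κ < 1/6`, Montvay–Münster (4.111));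
* §3 (the limit exchange) `limit_eq_zero_of_divergent_logRatio`: if eventually `0 ≤ S_k` and
  `e^{E_k} S_k ≤ S'_k` with `E_k → +∞`, and `S_k → L`, `S'_k → L'`, then `L = 0` — convergence at a SECOND separation
  replaces any uniform amplitude constant; §4 packages §1+§3 (`laplace_limit_eq_zero_of_receding_support`, the
  registered sub-goal) and §2+§3 (`spectralSum_limit_eq_zero_of_receding_spectrum`, with `k`-dependent lattice
  separations `n₀(k) ≤ n₁(k)` and the divergence stated on `E_k · (n₁(k) − n₀(k))`, i.e. in physical units).

How the stub would use them (NOT proved here): offset `→ +∞` along `φ` ⇒ the quarks realised at a fixed tuple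
`m > M` have corner-relative RGI mass `→ +∞` along `φ` ⇒ (MISSING renormalised spectral bound) the pseudoscalar
`f ≠ g` channel has spectral support above `R_k → ∞` in physical units ⇒ (§4) its two-point function vanishes in the
full-sequence limit `T` at every pair of separations ⇒ `¬ T.IsNontrivial (QCDField.pseudoRe f g)`, against the body.

References: M. Lüscher, Comm. Math. Phys. 54 (1977) 283 (positive transfer matrix for Wilson fermions);
I. Montvay, G. Münster, *Quantum Fields on a Lattice* (1994) §4.2.3 (4.111), §5.1 (5.84); T. Appelquist,
J. Carazzone, Phys. Rev. D 11 (1975) 2856 (decoupling); J. Glimm, A. Jaffe, *Quantum Physics* (1987) §6.1.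
-/

noncomputable section

namespace Summit.QuantumFields.QCD.Theorems.HonestHeavyAnchorDecoupling

open Filter Topology MeasureTheory
open scoped BigOperators
open Literature.MathematicalPhysics.QuantumFieldTheory

/-! ## §1 Continuum side: Laplace transforms of positive measures supported above `R` -/

/-- A Laplace transform of a positive measure is non-negative: `0 ≤ ∫ e^{−Et} dρ(E)`. [folklore] -/
theorem laplace_nonneg (ρ : Measure ℝ) (t : ℝ) : 0 ≤ ∫ E, Real.exp (-(E * t)) ∂ρ :=
  integral_nonneg fun _ => (Real.exp_pos _).le

/-- **Laplace transforms of positive measures supported above `R` fall at least like `e^{−R·Δt}`**: for a finite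
measure `ρ` on `ℝ` with `ρ (−∞, R) = 0`, `0 ≤ R` and `0 ≤ t' ≤ t₁`,
`e^{R (t₁ − t')} · ∫ e^{−E t₁} dρ(E) ≤ ∫ e^{−E t'} dρ(E)`. [folklore] -/
theorem laplace_ratio_lower_bound (ρ : Measure ℝ) [IsFiniteMeasure ρ] (R t' t₁ : ℝ) (hR : 0 ≤ R)
    (hsupp : ρ (Set.Iio R) = 0) (ht' : 0 ≤ t') (ht : t' ≤ t₁) :
    Real.exp (R * (t₁ - t')) * ∫ E, Real.exp (-(E * t₁)) ∂ρ ≤ ∫ E, Real.exp (-(E * t')) ∂ρ := by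
  have hae : ∀ᵐ E ∂ρ, R ≤ E := by
    have h := (measure_eq_zero_iff_ae_notMem.1 hsupp)
    filter_upwards [h] with E hE
    simpa [Set.mem_Iio, not_lt] using hE
  have hint : ∀ t : ℝ, 0 ≤ t → Integrable (fun E => Real.exp (-(E * t))) ρ := by
    intro t ht
    refine Integrable.mono' (integrable_const (1 : ℝ)) (by fun_prop) ?_
    filter_upwards [hae] with E hE
    rw [Real.norm_eq_abs, abs_of_pos (Real.exp_pos _), Real.exp_le_one_iff]
    have : 0 ≤ E * t := mul_nonneg (hR.trans hE) ht
    linarith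
  have ht₁ : 0 ≤ t₁ := ht'.trans ht
  rw [← integral_const_mul]
  refine integral_mono_ae ((hint t₁ ht₁).const_mul _) (hint t' ht') ?_
  filter_upwards [hae] with E hE
  rw [← Real.exp_add]
  refine Real.exp_le_exp.2 ?_
  have hdt : 0 ≤ t₁ - t' := by linarith
  nlinarith [mul_le_mul_of_nonneg_right hE hdt]

/-! ## §2 Lattice side: positive-type sequences (spectral sums of a positive transfer matrix) -/

/-- A spectral sum with non-negative weights and non-negative eigenvalues is non-negative:
`0 ≤ Σ_j w_j q_j^n`. [folklore] -/
theorem spectralSum_nonneg {ι : Type*} (J : Finset ι) (w q : ι → ℝ) (n : ℕ)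
    (hw : ∀ j ∈ J, 0 ≤ w j) (hq : ∀ j ∈ J, 0 ≤ q j) : 0 ≤ ∑ j ∈ J, w j * q j ^ n :=
  Finset.sum_nonneg fun j hj => mul_nonneg (hw j hj) (pow_nonneg (hq j hj) n)

/-- **Positive-type sequences with spectrum below `e^{−E}` fall at least like `e^{−E·Δn}`**: for
`s(n) = Σ_{j ∈ J} w_j q_j^n` with `w_j ≥ 0` and `0 ≤ q_j ≤ e^{−E}`, and `n₀ ≤ n₁`,
`e^{E (n₁ − n₀)} s(n₁) ≤ s(n₀)` — the transfer-matrix form of `laplace_ratio_lower_bound`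
(`s(n) = ⟨v, 𝕋ⁿ v⟩` for a positive transfer matrix whose spectrum on the relevant sector lies in `[0, e^{−E}]`). [folklore] -/
theorem spectralSum_ratio_lower_bound {ι : Type*} (J : Finset ι) (w q : ι → ℝ) (E : ℝ) {n₀ n₁ : ℕ}
    (hw : ∀ j ∈ J, 0 ≤ w j) (hq : ∀ j ∈ J, 0 ≤ q j) (hqE : ∀ j ∈ J, q j ≤ Real.exp (-E)) (hn : n₀ ≤ n₁) :
    Real.exp (E * ((n₁ : ℝ) - n₀)) * ∑ j ∈ J, w j * q j ^ n₁ ≤ ∑ j ∈ J, w j * q j ^ n₀ := by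
  have hexp : Real.exp (E * ((n₁ : ℝ) - n₀)) * Real.exp (-E) ^ (n₁ - n₀) = 1 := by
    rw [← Real.exp_nat_mul, ← Real.exp_add, Nat.cast_sub hn, ← Real.exp_zero]
    congr 1
    ring
  rw [Finset.mul_sum]
  refine Finset.sum_le_sum fun j hj => ?_
  have hd : q j ^ (n₁ - n₀) ≤ Real.exp (-E) ^ (n₁ - n₀) := pow_le_pow_left₀ (hq j hj) (hqE j hj) _
  have hsplit : q j ^ n₁ = q j ^ n₀ * q j ^ (n₁ - n₀) := by
    rw [← pow_add, Nat.add_sub_cancel' hn]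
  calc Real.exp (E * ((n₁ : ℝ) - n₀)) * (w j * q j ^ n₁)
      = w j * q j ^ n₀ * (Real.exp (E * ((n₁ : ℝ) - n₀)) * q j ^ (n₁ - n₀)) := by
        rw [hsplit]; ring
    _ ≤ w j * q j ^ n₀ * (Real.exp (E * ((n₁ : ℝ) - n₀)) * Real.exp (-E) ^ (n₁ - n₀)) :=
        mul_le_mul_of_nonneg_left (mul_le_mul_of_nonneg_left hd (Real.exp_pos _).le)
          (mul_nonneg (hw j hj) (pow_nonneg (hq j hj) _))
    _ = w j * q j ^ n₀ := by rw [hexp, mul_one]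

/-! ## §3 The limit exchange: a divergent log-ratio forces the limit at the larger separation to vanish -/

/-- **The decoupling mechanism (general form).**  If eventually `0 ≤ S_k` and `e^{E_k} S_k ≤ S'_k` with
`E_k → +∞`, and both `S_k → L` and `S'_k → L'` converge, then `L = 0`: were `L > 0`, `S'_k ≥ e^{E_k} L/2 → ∞`
could not converge.  No uniform amplitude constant is needed — convergence at the second separation replaces it. [folklore] -/
theorem limit_eq_zero_of_divergent_logRatio (S₁ S' E : ℕ → ℝ) (L L' : ℝ)
    (hpos : ∀ᶠ k in atTop, 0 ≤ S₁ k) (hdom : ∀ᶠ k in atTop, Real.exp (E k) * S₁ k ≤ S' k)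
    (hE : Tendsto E atTop atTop) (h₁ : Tendsto S₁ atTop (𝓝 L)) (h' : Tendsto S' atTop (𝓝 L')) :
    L = 0 := by
  have hL0 : 0 ≤ L := ge_of_tendsto h₁ hpos
  by_contra hne
  have hLpos : 0 < L := lt_of_le_of_ne hL0 (Ne.symm hne)
  have hS₁ : ∀ᶠ k in atTop, L / 2 ≤ S₁ k := (h₁.eventually_const_lt (by linarith)).mono fun k hk => hk.le
  have hexp : Tendsto (fun k => Real.exp (E k)) atTop atTop := Real.tendsto_exp_atTop.comp hE
  have hprod : Tendsto (fun k => Real.exp (E k) * (L / 2)) atTop atTop :=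
    hexp.atTop_mul_const (by linarith)
  have hS' : Tendsto S' atTop atTop := by
    refine tendsto_atTop_mono' atTop ?_ hprod
    filter_upwards [hS₁, hdom] with k hk hd
    calc Real.exp (E k) * (L / 2) ≤ Real.exp (E k) * S₁ k :=
          mul_le_mul_of_nonneg_left hk (Real.exp_pos _).le
      _ ≤ S' k := hd
  exact not_tendsto_nhds_of_tendsto_atTop hS' L' h'

/-- **The decoupling mechanism (skeleton form, `Lines/bounded_locator.lean` §6).**  If `0 ≤ S_k(t₁)`,
`e^{R_k (t₁ − t')} S_k(t₁) ≤ S_k(t')` with `R_k → +∞` and `t' < t₁`, and both `S_k(t₁) → L` and `S_k(t') → L'`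
converge, then `L = 0`. [folklore] -/
theorem limit_eq_zero_of_divergent_ratio (S₁ S' R : ℕ → ℝ) (t' t₁ L L' : ℝ) (htt : t' < t₁)
    (hpos : ∀ k, 0 ≤ S₁ k) (hdom : ∀ k, Real.exp (R k * (t₁ - t')) * S₁ k ≤ S' k)
    (hR : Tendsto R atTop atTop) (h₁ : Tendsto S₁ atTop (𝓝 L)) (h' : Tendsto S' atTop (𝓝 L')) : L = 0 :=
  limit_eq_zero_of_divergent_logRatio S₁ S' (fun k => R k * (t₁ - t')) L L' (Eventually.of_forall hpos)
    (Eventually.of_forall hdom) (hR.atTop_mul_const (by linarith)) h₁ h'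

/-! ## §4 Packaged: receding spectral support kills the limit at two separations -/

/-- **Decoupling of a channel whose spectral support recedes to infinity (continuum form; the registered
sub-goal of this helper).**  Let `ρ_k` be finite positive measures on `ℝ` (spectral measures of one channel along a
sequence of theories), eventually supported in `[R_k, ∞)` with `R_k → +∞`, and let `0 ≤ t' < t₁`.  If the Laplace
transforms converge at both separations, `∫ e^{−E t₁} dρ_k → L` and `∫ e^{−E t'} dρ_k → L'`, then `L = 0`: the
two-point function of the channel vanishes in the limit at the larger separation — the channel DECOUPLES, so a
limit theory in which it is non-trivial (`OSData.IsNontrivial`) cannot exist. [folklore] -/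
theorem laplace_limit_eq_zero_of_receding_support :
    ∀ (ρ : ℕ → MeasureTheory.Measure ℝ) (R : ℕ → ℝ) (t' t₁ L L' : ℝ),
      (∀ k, MeasureTheory.IsFiniteMeasure (ρ k)) → 0 ≤ t' → t' < t₁ →
      (∀ᶠ k in atTop, ρ k (Set.Iio (R k)) = 0) → Tendsto R atTop atTop →
      Tendsto (fun k => ∫ E, Real.exp (-(E * t₁)) ∂ρ k) atTop (𝓝 L) →
      Tendsto (fun k => ∫ E, Real.exp (-(E * t')) ∂ρ k) atTop (𝓝 L') → L = 0 := by
  intro ρ R t' t₁ L L' hfin ht' htt hsupp hR h₁ h'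
  refine limit_eq_zero_of_divergent_logRatio (fun k => ∫ E, Real.exp (-(E * t₁)) ∂ρ k)
    (fun k => ∫ E, Real.exp (-(E * t')) ∂ρ k) (fun k => R k * (t₁ - t')) L L'
    (Eventually.of_forall fun k => laplace_nonneg (ρ k) t₁) ?_ (hR.atTop_mul_const (by linarith)) h₁ h'
  filter_upwards [hsupp, hR.eventually_ge_atTop 0] with k hk hRk
  haveI := hfin k
  exact laplace_ratio_lower_bound (ρ k) (R k) t' t₁ hRk hk ht' htt.le

/-- **Decoupling of a channel whose transfer-matrix spectrum recedes (lattice form).**  Along a sequence `k` of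
lattice theories let the channel's time-slice correlator be the positive-type sequence
`s_k(n) = Σ_{j ∈ J_k} w_{k,j} q_{k,j}^n` with `w_{k,j} ≥ 0`, `0 ≤ q_{k,j} ≤ e^{−E_k}` (eventually in `k`), read at two
lattice separations `n₀(k) ≤ n₁(k)` (e.g. `⌊t'/a_k⌋ ≤ ⌊t₁/a_k⌋`) whose rate-weighted gap diverges,
`E_k · (n₁(k) − n₀(k)) → +∞` (rate `E_k/a_k → ∞` in physical units at fixed physical separations).  If
`s_k(n₁(k)) → L` and `s_k(n₀(k)) → L'`, then `L = 0`. [folklore] -/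
theorem spectralSum_limit_eq_zero_of_receding_spectrum {ι : Type*} (J : ℕ → Finset ι) (w q : ℕ → ι → ℝ)
    (E : ℕ → ℝ) (n₀ n₁ : ℕ → ℕ) (L L' : ℝ)
    (hw : ∀ᶠ k in atTop, ∀ j ∈ J k, 0 ≤ w k j) (hq : ∀ᶠ k in atTop, ∀ j ∈ J k, 0 ≤ q k j)
    (hqE : ∀ᶠ k in atTop, ∀ j ∈ J k, q k j ≤ Real.exp (-E k)) (hn : ∀ᶠ k in atTop, n₀ k ≤ n₁ k)
    (hdiv : Tendsto (fun k => E k * ((n₁ k : ℝ) - n₀ k)) atTop atTop)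
    (h₁ : Tendsto (fun k => ∑ j ∈ J k, w k j * q k j ^ n₁ k) atTop (𝓝 L))
    (h' : Tendsto (fun k => ∑ j ∈ J k, w k j * q k j ^ n₀ k) atTop (𝓝 L')) : L = 0 := by
  refine limit_eq_zero_of_divergent_logRatio (fun k => ∑ j ∈ J k, w k j * q k j ^ n₁ k)
    (fun k => ∑ j ∈ J k, w k j * q k j ^ n₀ k) (fun k => E k * ((n₁ k : ℝ) - n₀ k)) L L' ?_ ?_ hdiv h₁ h'
  · filter_upwards [hw, hq] with k hwk hqk
    exact spectralSum_nonneg (J k) (w k) (q k) (n₁ k) hwk hqk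
  · filter_upwards [hw, hq, hqE, hn] with k hwk hqk hqEk hnk
    exact spectralSum_ratio_lower_bound (J k) (w k) (q k) (E k) hwk hqk hqEk hnk

end Summit.QuantumFields.QCD.Theorems.HonestHeavyAnchorDecoupling

end
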